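import Literature.AlgebraicGeometry.Resolution.SingUnramifiedRing
import Literature.AlgebraicGeometry.Resolution.RegularLocusPerfectField
import Literature.AlgebraicGeometry.Resolution.AdicQuotient
import Literature.RingTheory.FittingIdeal.LocalRing
import Mathlib.RingTheory.Smooth.Kaehler
import Mathlib.RingTheory.Artinian.Ring
import Mathlib.RingTheory.LocalProperties.Reduced
import HarnessLib

/-!
# The smooth locus of a nodal curve over an algebraically closed field is the complement of `V(Fitt₁ Ω)` (Stacks 0C3K, 0C4D)

Topic: `Literature/AlgebraicGeometry/Resolution`. Ring-theoretic core, over an ALGEBRAICALLY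
CLOSED field, of the discharge of the named fact `DeJong1996SmoothIffDifferentialsCyclic`
(`AlterationsSingFitting.lean`; de Jong 1996, 3.1 with 2.21; The Stacks Project, Tag 01V9
(1) ⇔ (3) and Tag 0C3K: "the closed subscheme cut out by the `d`-th Fitting ideal of `Ω_{X/S}`
is exactly the set of points where `f` is not smooth", `d = 1`). For a finite type algebra `G`
over `K = K̄` whose local rings at the maximal ideals are those of a semi-stable curve (regular of
dimension `1`, or an ordinary double point, i.e. dimension `1`, reduced, not regular, with
completion `K⟦u, v⟧/(uv)` — the ring-theoretic invariants of `IsOrdinaryDoublePoint`), everything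
is PROVED:

* at a maximal ideal `𝔪` (residue field `K`, Nullstellensatz, `SingUnramifiedRing.lean`):
  smooth ⟺ regular (`isSmoothAt_iff_isRegularLocalRing_of_perfectField`); regular of dimension
  `1` ⟹ `𝔪` principal ⟹ `Fitt₁(Ω_{G_𝔪/K}) = G_𝔪`
  (`fittingIdeal_kaehler_eq_top_of_isRegularLocalRing_of_ringKrullDim_eq_one`); conversely
  `Fitt₁ = G_𝔪` ⟹ `𝔪` principal (`isPrincipal_maximalIdeal_of_fittingIdeal_kaehler_eq_top`: the
  conormal map `𝔪/𝔪² → K ⊗ Ω` is split injective at a rational point, Mathlib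
  `retractionKerCotangentToTensorEquivSection`, so `dim 𝔪/𝔪² ≤ dim K ⊗ Ω ≤ 1`), hence at a node
  `Fitt₁ ≠ G_𝔪` (`fittingIdeal_kaehler_ne_top_of_not_isRegularLocalRing`) while `𝔪 ⊆ Fitt₁`
  (Stacks 0C4D, `NodeFittingIdeal.lean`);
* at a non-maximal prime `Q ⊊ 𝔪`: `G_Q` is a field (`isField_localization_of_ne_maximalIdeal`:
  a reduced Noetherian local ring of dimension `≤ 1` localized at a non-maximal prime), hence
  smooth over the perfect `K` (Mathlib `Algebra.FormallySmooth.of_perfectField`), and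
  `Fitt₁ ⊄ Q`;
* `isSmoothAt_iff_not_fittingIdeal_le_of_isAlgClosed` — THE STATEMENT: `G` is `K`-smooth at a
  prime `Q` iff `Fitt₁(Ω_{G/K}) ⊄ Q`;
* transport of the hypothesis along ring isomorphisms (`isRegularLocalRing_or_node_of_ringEquiv`,
  `Localization.nonempty_atPrime_ringEquiv_of_ringEquiv`) and two bookkeeping lemmas on extended ideals
  (`Ideal.map_eq_top_iff_of_isLocalHom`, `IsLocalization.AtPrime.map_eq_top_iff_not_le`).

## Sources

* The Stacks Project, Tags 0C3K, 0C4D, 07ZC, 00TV. [StacksProject]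
* A. J. de Jong, *Smoothness, semi-stability and alterations*, Publ. Math. IHÉS 83 (1996), 2.21,
  2.23, 3.1 (pp. 61–62). [DeJong1996]
-/

noncomputable section

open IsLocalRing TensorProduct

namespace Literature.AlgebraicGeometry.Resolution

open Literature.RingTheory.FittingIdeal

universe u v w

/-! ## Extended ideals: along a local homomorphism, and at a prime -/

section Jacobian

/-- Along a local homomorphism, an ideal extends to the unit ideal iff it is the unit ideal.
[folklore] -/
theorem Ideal.map_eq_top_iff_of_isLocalHom {A B : Type*} [CommRing A] [CommRing B]
    [IsLocalRing A] [IsLocalRing B] (f : A →+* B) [IsLocalHom f] (I : Ideal A) :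
    I.map f = ⊤ ↔ I = ⊤ := by
  constructor
  · intro h
    by_contra hI
    have h1 : I.map f ≤ maximalIdeal B :=
      (Ideal.map_mono (le_maximalIdeal hI)).trans
        (((IsLocalRing.local_hom_TFAE f).out 0 2 rfl rfl).mp ‹_›)
    exact (maximalIdeal.isMaximal B).ne_top (top_le_iff.mp (h ▸ h1))
  · rintro rfl
    exact Ideal.map_top f

/-- **Stacks 07ZC at a prime**: an ideal `I` (e.g. `Fitt₁(Ω)`) extends to the unit ideal of `R_𝔮`
iff `I ⊄ 𝔮` — the complement of `V(I)`. [folklore] -/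
theorem IsLocalization.AtPrime.map_eq_top_iff_not_le {R : Type*} [CommRing R] (q : Ideal R)
    [q.IsPrime] (Rq : Type*) [CommRing Rq] [Algebra R Rq] [IsLocalization.AtPrime Rq q]
    (I : Ideal R) : I.map (algebraMap R Rq) = ⊤ ↔ ¬ I ≤ q := by
  haveI := IsLocalization.AtPrime.isLocalRing Rq q
  constructor
  · intro h hle
    have : I.map (algebraMap R Rq) ≤ maximalIdeal Rq := by
      rw [← IsLocalization.AtPrime.map_eq_maximalIdeal q Rq]
      exact Ideal.map_mono hle
    exact (maximalIdeal.isMaximal Rq).ne_top (top_le_iff.mp (h ▸ this))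
  · intro h
    obtain ⟨x, hxI, hxq⟩ := Set.not_subset.mp h
    exact Ideal.eq_top_of_isUnit_mem _ (Ideal.mem_map_of_mem _ hxI)
      (IsLocalization.map_units (M := q.primeCompl) Rq ⟨x, hxq⟩)

end Jacobian

/-! ## The local rings at the closed points: regular of dimension one, or a node -/

section LocalAlgebra

variable {K : Type u} [Field K] {B : Type v} [CommRing B] [IsLocalRing B] [Algebra K B]

/-- **A regular one-dimensional local ring is off the singular scheme**: for a regular local
`K`-algebra `(B, 𝔪)` of dimension `1` with residue field `K` and `Ω_{B/K}` finite, `𝔪` is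
principal and `Fitt₁(Ω_{B/K}) = B` (The Stacks Project, Tag 0C3K: `V(Fitt_d Ω_{X/S})` is the
non-smooth locus; here through `Ω_{B/K} = B dπ`, `NodeFittingIdeal.lean`).
[cite: StacksProject, Tag 0C3K] -/
theorem fittingIdeal_kaehler_eq_top_of_isRegularLocalRing_of_ringKrullDim_eq_one
    [IsNoetherianRing B] [Module.Finite B Ω[B⁄K]]
    (hK : ∀ b : B, ∃ c : K, b - algebraMap K B c ∈ maximalIdeal B) (hreg : IsRegularLocalRing B)
    (hdim : ringKrullDim B = 1) : Module.fittingIdeal B Ω[B⁄K] 1 = ⊤ := by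
  haveI := hreg
  have hfin : Module.finrank (ResidueField B) (CotangentSpace B) = 1 := by
    have h := (IsRegularLocalRing.iff_finrank_cotangentSpace B).mp ‹_›
    rw [hdim] at h
    exact_mod_cast h
  have hprinc : (maximalIdeal B).IsPrincipal := finrank_cotangentSpace_le_one_iff.mp hfin.le
  obtain ⟨π, hπ⟩ := hprinc.principal
  refine Module.fittingIdeal_kaehler_eq_top_of_maximalIdeal_eq_span hK (fun _ : Fin 1 => π) ?_
  rw [Set.range_const]
  exact hπ

set_option backward.isDefEq.respectTransparency false in
/-- **A cyclic `Ω` forces a principal maximal ideal, at a rational point**: for a Noetherian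
local `K`-algebra `(B, 𝔪)` with residue field `K` and `Ω_{B/K}` finite, if `Fitt₁(Ω_{B/K}) = B`
then `𝔪` is principal. Indeed `Ω_{B/K} = B ω` (Stacks 07ZC), and the conormal map
`𝔪/𝔪² → K ⊗_B Ω_{B/K}` is (split) injective because `B/𝔪² → K` has the `K`-algebra section
`K → B/𝔪²` (Mathlib `retractionKerCotangentToTensorEquivSection`), so
`dim_K 𝔪/𝔪² ≤ dim_K (K ⊗_B Ω_{B/K}) ≤ 1`. [cite: StacksProject, Tag 0C3K] -/
theorem isPrincipal_maximalIdeal_of_fittingIdeal_kaehler_eq_top [IsNoetherianRing B]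
    [Module.Finite B Ω[B⁄K]]
    (hK : ∀ b : B, ∃ c : K, b - algebraMap K B c ∈ maximalIdeal B)
    (h : Module.fittingIdeal B Ω[B⁄K] 1 = ⊤) : (maximalIdeal B).IsPrincipal := by
  classical
  let k := ResidueField B
  -- `K → k` is a bijection
  have hsurjK : Function.Surjective (algebraMap K k) := by
    intro c'
    obtain ⟨b, rfl⟩ := residue_surjective c'
    obtain ⟨c, hc⟩ := hK b
    refine ⟨c, ?_⟩
    rw [IsScalarTower.algebraMap_apply K B k, ResidueField.algebraMap_eq, eq_comm, ← sub_eq_zero,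
      ← map_sub, residue_eq_zero_iff]
    exact hc
  let ι : K ≃ₐ[K] k :=
    AlgEquiv.ofBijective (Algebra.ofId K k) ⟨(algebraMap K k).injective, hsurjK⟩
  -- the residue map `B → k` and its kernel
  have hsurj : Function.Surjective (algebraMap B k) := by
    rw [ResidueField.algebraMap_eq]; exact residue_surjective
  have hker : RingHom.ker (algebraMap B k) = maximalIdeal B := by
    rw [ResidueField.algebraMap_eq]; exact ker_residue
  -- a `K`-algebra section of `B/𝔪² → k`, hence a retraction of `𝔪/𝔪² → k ⊗ Ω`
  let g : k →ₐ[K] B ⧸ RingHom.ker (algebraMap B k) ^ 2 :=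
    (IsScalarTower.toAlgHom K B _).comp ((Algebra.ofId K B).comp (ι.symm : k →ₐ[K] K))
  have hg : (IsScalarTower.toAlgHom K B k).kerSquareLift.comp g = AlgHom.id K k := by
    ext x
    obtain ⟨c, rfl⟩ := ι.surjective x
    change (IsScalarTower.toAlgHom K B k).kerSquareLift
      (algebraMap B _ (algebraMap K B (ι.symm (ι c)))) = ι c
    rw [ι.symm_apply_apply, ← IsScalarTower.algebraMap_apply K B, AlgHom.commutes]
    rfl
  obtain ⟨l, hl⟩ :=
    (retractionKerCotangentToTensorEquivSection (R := K) (P := B) (S := k) hsurj).symm ⟨g, hg⟩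
  have hinj : Function.Injective (KaehlerDifferential.kerCotangentToTensor K B k) :=
    Function.LeftInverse.injective (g := l) fun x => LinearMap.congr_fun hl x
  -- `𝔪/𝔪² ↪ k ⊗ Ω`, `B`-linearly, hence `k`-linearly
  let f : CotangentSpace B →ₗ[B] k ⊗[B] Ω[B⁄K] :=
    KaehlerDifferential.kerCotangentToTensor K B k ∘ₗ
      (Ideal.Cotangent.equivOfEq _ _ hker.symm).toLinearMap
  have hf : Function.Injective f := hinj.comp (LinearEquiv.injective _)
  let f' : CotangentSpace B →ₗ[k] k ⊗[B] Ω[B⁄K] := f.extendScalarsOfSurjective hsurj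
  have hf' : Function.Injective f' := fun x y hxy => hf (by
    have h₁ : f' x = f x := LinearMap.extendScalarsOfSurjective_apply hsurj f x
    have h₂ : f' y = f y := LinearMap.extendScalarsOfSurjective_apply hsurj f y
    rw [← h₁, ← h₂]
    exact hxy)
  -- `k ⊗ Ω` is spanned by one element
  obtain ⟨ω, hω⟩ := Module.fittingIdeal_one_eq_top_iff.mp h
  have hspan : Submodule.span k {(1 : k) ⊗ₜ[B] ω} = ⊤ := by
    have := Submodule.baseChange_span (R := B) (A := k) (M := Ω[B⁄K]) {ω}
    rw [hω, Submodule.baseChange_top, Set.image_singleton] at this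
    exact this.symm
  have hV : Module.finrank k (k ⊗[B] Ω[B⁄K]) ≤ 1 := by
    rw [← finrank_top, ← hspan]
    exact (finrank_span_le_card ({(1 : k) ⊗ₜ[B] ω} : Set (k ⊗[B] Ω[B⁄K]))).trans (by simp)
  have hle : Module.finrank k (CotangentSpace B) ≤ 1 :=
    (LinearMap.finrank_le_finrank_of_injective hf').trans hV
  exact finrank_cotangentSpace_le_one_iff.mp hle

/-- **At a rational singular point of a curve, `Fitt₁(Ω) ≠ B`**: a Noetherian local `K`-algebra
`(B, 𝔪)` of dimension `1` with residue field `K` and `Ω_{B/K}` finite which is NOT regular has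
`Fitt₁(Ω_{B/K}) ≠ B` (otherwise `𝔪` is principal and `B` regular). [cite: StacksProject, Tag 0C3K] -/
theorem fittingIdeal_kaehler_ne_top_of_not_isRegularLocalRing [IsNoetherianRing B]
    [Module.Finite B Ω[B⁄K]]
    (hK : ∀ b : B, ∃ c : K, b - algebraMap K B c ∈ maximalIdeal B)
    (hreg : ¬ IsRegularLocalRing B) (hdim : ringKrullDim B = 1) :
    Module.fittingIdeal B Ω[B⁄K] 1 ≠ ⊤ := by
  intro h
  have hprinc := isPrincipal_maximalIdeal_of_fittingIdeal_kaehler_eq_top hK h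
  have h1 : Module.finrank (ResidueField B) (CotangentSpace B) ≤ 1 :=
    finrank_cotangentSpace_le_one_iff.mpr hprinc
  apply hreg
  rw [IsRegularLocalRing.iff_finrank_cotangentSpace, hdim]
  have h2 : ringKrullDim B ≤ (Module.finrank (ResidueField B) (CotangentSpace B) : WithBot ℕ∞) := by
    rw [← spanFinrank_maximalIdeal_eq_finrank_cotangentSpace]
    exact ringKrullDim_le_spanFinrank_maximalIdeal B
  rw [hdim] at h2
  have h3 : 1 ≤ Module.finrank (ResidueField B) (CotangentSpace B) := by exact_mod_cast h2
  have : Module.finrank (ResidueField B) (CotangentSpace B) = 1 := le_antisymm h1 h3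
  rw [this]
  rfl

omit [IsLocalRing B] [Algebra K B] in
/-- In a reduced ring a nilpotent ideal is zero. [folklore] -/
theorem Ideal.eq_bot_of_isNilpotent_of_isReduced [IsReduced B] {I : Ideal B} (hI : IsNilpotent I) :
    I = ⊥ := by
  obtain ⟨n, hn⟩ := hI
  rw [eq_bot_iff]
  intro x hx
  have : x ^ n ∈ I ^ n := Ideal.pow_mem_pow hx n
  rw [hn] at this
  exact IsReduced.eq_zero x ⟨n, this⟩

omit [Algebra K B] in
/-- **The generic points of a reduced curve are fields**: in a reduced Noetherian local ring of
dimension `≤ 1`, the localization at a non-maximal prime is a field. [folklore] -/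
theorem isField_localization_of_ne_maximalIdeal [IsNoetherianRing B] [IsReduced B]
    (hdim : ringKrullDim B ≤ 1) (Q : Ideal B) [Q.IsPrime] (hQ : Q ≠ maximalIdeal B)
    (L : Type v) [CommRing L] [Algebra B L] [IsLocalization.AtPrime L Q] : IsField L := by
  haveI := IsLocalization.AtPrime.isLocalRing L Q
  -- `height Q = 0`
  have hlt : Q < maximalIdeal B := lt_of_le_of_ne (le_maximalIdeal Ideal.IsPrime.ne_top') hQ
  have h1 := Ideal.height_add_one_le_of_lt_of_isPrime hlt
  have h2 : ((maximalIdeal B).height : WithBot ℕ∞) ≤ 1 := by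
    rw [IsLocalRing.maximalIdeal_height_eq_ringKrullDim]; exact hdim
  have h3 : (maximalIdeal B).height ≤ 1 := by exact_mod_cast h2
  have hQ0 : Q.height = 0 := by
    have h4 : Q.height + 1 ≤ 1 := h1.trans h3
    have hne : Q.height ≠ ⊤ := by
      intro htop
      rw [htop] at h4
      simp at h4
    exact Order.lt_one_iff.mp ((ENat.add_one_le_iff hne).mp h4)
  -- so `L` is Artinian local and reduced: a field
  have hdimL : ringKrullDim L = 0 := by
    rw [IsLocalization.AtPrime.ringKrullDim_eq_height Q L, hQ0]; rfl
  haveI : IsNoetherianRing L := IsLocalization.isNoetherianRing Q.primeCompl L inferInstance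
  haveI : Ring.KrullDimLE 0 L := Ring.krullDimLE_iff.mpr hdimL.le
  haveI : IsArtinianRing L := isArtinianRing_iff_isNoetherianRing_krullDimLE_zero.mpr ⟨‹_›, ‹_›⟩
  haveI : IsReduced L := isReduced_localizationPreserves Q.primeCompl L inferInstance
  have hnil : IsNilpotent (maximalIdeal L) := by
    rw [← IsLocalRing.jacobson_eq_maximalIdeal (⊥ : Ideal L) bot_ne_top]
    exact IsArtinianRing.isNilpotent_jacobson_bot
  rw [IsLocalRing.isField_iff_maximalIdeal_eq]
  exact Ideal.eq_bot_of_isNilpotent_of_isReduced hnil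

end LocalAlgebra

/-! ## Over an algebraically closed field: smooth locus = complement of `V(Fitt₁ Ω)` -/

section AlgClosed

variable (K : Type u) [Field K] [IsAlgClosed K] (G : Type u) [CommRing G] [Algebra K G]
  [Algebra.FiniteType K G]

/-- **The smooth locus of a curve with at worst nodal singularities over an algebraically closed
field is the complement of `V(Fitt₁ Ω)`** (The Stacks Project, Tag 0C3K for `d = 1`, with
Tag 0C4D (1) ⇒ (4) at the nodes). Let `G` be of finite type over the algebraically closed `K`
such that at every maximal ideal `𝔪` the local ring `G_𝔪` is either regular of dimension `1`, or
of dimension `1`, reduced, not regular, with completion `K⟦u, v⟧/(uv)` (an ordinary double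
point). Then for every prime `Q`: `G` is `K`-smooth at `Q` iff `Fitt₁(Ω_{G/K}) ⊄ Q`. At a
maximal `𝔪`: smooth ⟺ regular (perfect ground field), regular ⟹ `Fitt₁ · G_𝔪 = G_𝔪`, node ⟹
`𝔪 G_𝔪 ⊆ Fitt₁ · G_𝔪 ≠ G_𝔪`; at a non-maximal `Q ⊊ 𝔪`: `G_Q` is a field, hence smooth
(`K` perfect), and `Fitt₁ ⊄ Q` since `𝔪 G_𝔪 ⊆ Fitt₁ G_𝔪`. [cite: StacksProject, Tag 0C3K] -/
theorem isSmoothAt_iff_not_fittingIdeal_le_of_isAlgClosed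
    (HG : ∀ (m : Ideal G) [m.IsMaximal],
      (IsRegularLocalRing (Localization.AtPrime m) ∧
          ringKrullDim (Localization.AtPrime m) = 1) ∨
        (ringKrullDim (Localization.AtPrime m) = 1 ∧ IsReduced (Localization.AtPrime m) ∧
          ¬ IsRegularLocalRing (Localization.AtPrime m) ∧
          Nonempty (AdicCompletion (maximalIdeal (Localization.AtPrime m))
              (Localization.AtPrime m) ≃+*
            MvPowerSeries (Fin 2) K ⧸
              Ideal.span {(MvPowerSeries.X 0 * MvPowerSeries.X 1 : MvPowerSeries (Fin 2) K)})))
    (Q : Ideal G) [Q.IsPrime] :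
    Algebra.IsSmoothAt K Q ↔ ¬ Module.fittingIdeal G Ω[G⁄K] 1 ≤ Q := by
  classical
  haveI : IsNoetherianRing G := Algebra.FiniteType.isNoetherianRing K G
  haveI : Algebra.FinitePresentation K G := (Algebra.FinitePresentation.of_finiteType).mp ‹_›
  set J : Ideal G := Module.fittingIdeal G Ω[G⁄K] 1 with hJ
  -- Step 1: the local rings at the maximal ideals
  have step1 : ∀ (m : Ideal G) [m.IsMaximal],
      maximalIdeal (Localization.AtPrime m) ≤ J.map (algebraMap G (Localization.AtPrime m)) ∧
      (Algebra.IsSmoothAt K m ↔ ¬ J ≤ m) ∧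
      ringKrullDim (Localization.AtPrime m) ≤ 1 ∧ IsReduced (Localization.AtPrime m) := by
    intro m _
    let Bm := Localization.AtPrime m
    haveI : IsNoetherianRing Bm := IsLocalization.isNoetherianRing m.primeCompl Bm inferInstance
    haveI : Algebra.EssFiniteType K Bm :=
      Algebra.EssFiniteType.comp K G Bm
    have hK : ∀ b : Bm, ∃ c : K, b - algebraMap K Bm c ∈ maximalIdeal Bm :=
      exists_sub_algebraMap_mem_maximalIdeal_of_isMaximal K m
    have hJm : Module.fittingIdeal Bm Ω[Bm⁄K] 1 = J.map (algebraMap G Bm) :=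
      Module.fittingIdeal_kaehlerDifferential_of_isLocalization' m.primeCompl 1
    have hsm : Algebra.IsSmoothAt K m ↔ IsRegularLocalRing Bm :=
      isSmoothAt_iff_isRegularLocalRing_of_perfectField K G m
    have hle : ¬ J ≤ m ↔ J.map (algebraMap G Bm) = ⊤ :=
      (IsLocalization.AtPrime.map_eq_top_iff_not_le m Bm J).symm
    rcases HG m with ⟨hreg, hdim⟩ | ⟨hdim, hred, hreg, ⟨e⟩⟩
    · haveI := hreg
      have htop : J.map (algebraMap G Bm) = ⊤ := by
        rw [← hJm]
        exact fittingIdeal_kaehler_eq_top_of_isRegularLocalRing_of_ringKrullDim_eq_one hK hreg hdim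
      haveI : IsDomain Bm := isDomain_of_isRegularLocalRing Bm
      refine ⟨htop ▸ le_top, ?_, hdim.le, inferInstance⟩
      rw [hsm, hle]
      exact ⟨fun _ => htop, fun _ => hreg⟩
    · have hmle : maximalIdeal Bm ≤ J.map (algebraMap G Bm) := by
        rw [← hJm]
        exact maximalIdeal_le_fittingIdeal_kaehler_of_ringEquiv_adicCompletion hK e
      have hne : J.map (algebraMap G Bm) ≠ ⊤ := by
        rw [← hJm]
        exact fittingIdeal_kaehler_ne_top_of_not_isRegularLocalRing hK hreg hdim
      refine ⟨hmle, ?_, hdim.le, hred⟩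
      rw [hsm, hle]
      exact ⟨fun h => absurd h hreg, fun h => absurd h hne⟩
  -- Step 2: a prime `Q`; if maximal we are done
  by_cases hQmax : Q.IsMaximal
  · exact (step1 Q).2.1
  obtain ⟨m, hm, hQm⟩ := Ideal.exists_le_maximal Q Ideal.IsPrime.ne_top'
  haveI := hm
  have hQne : Q ≠ m := fun h => hQmax (h ▸ hm)
  obtain ⟨hmle, -, hdim, hred⟩ := step1 m
  let Bm := Localization.AtPrime m
  haveI : IsNoetherianRing Bm := IsLocalization.isNoetherianRing m.primeCompl Bm inferInstance
  haveI : IsReduced Bm := hred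
  -- the prime `Q' = Q G_𝔪` of `G_𝔪`, not maximal, and `G_Q = (G_𝔪)_{Q'}`
  have hdisj : Disjoint (m.primeCompl : Set G) (Q : Set G) := by
    rw [Set.disjoint_left]
    intro x hx hxQ
    exact hx (hQm hxQ)
  let Q' : Ideal Bm := Q.map (algebraMap G Bm)
  haveI hQ' : Q'.IsPrime := IsLocalization.isPrime_of_isPrime_disjoint m.primeCompl Bm Q ‹_› hdisj
  have hQ'u : Q'.under G = Q := IsLocalization.under_map_of_isPrime_disjoint m.primeCompl Bm ‹_› hdisj
  have hQ'ne : Q' ≠ maximalIdeal Bm := by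
    intro h
    apply hQne
    rw [← hQ'u, h, Localization.AtPrime.under_maximalIdeal]
  constructor
  · -- `Fitt₁ ⊄ Q`
    intro _ hJQ
    apply hQ'ne
    refine ((IsLocalRing.maximalIdeal.isMaximal Bm).eq_of_le hQ'.ne_top ?_).symm
    exact hmle.trans (Ideal.map_mono hJQ)
  · -- `G_Q` is a field, essentially of finite type over the perfect `K`: smooth
    intro _
    let L := Localization.AtPrime Q'
    have hL' : IsLocalization.AtPrime L (Q'.under G) :=
      IsLocalization.isLocalization_isLocalization_atPrime_isLocalization m.primeCompl L Q'
    have hS : (Q'.under G).primeCompl = Q.primeCompl := by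
      ext x
      change x ∉ Q'.under G ↔ x ∉ Q
      rw [hQ'u]
    have hL : IsLocalization.AtPrime L Q := by
      change IsLocalization (Q'.under G).primeCompl L at hL'
      rwa [hS] at hL'
    have hfield : IsField L := isField_localization_of_ne_maximalIdeal hdim Q' hQ'ne L
    letI : Field L := hfield.toField
    haveI : Algebra.EssFiniteType K L := by
      haveI : Algebra.EssFiniteType K Bm := Algebra.EssFiniteType.comp K G Bm
      haveI : Algebra.EssFiniteType Bm L := Algebra.EssFiniteType.of_isLocalization L Q'.primeCompl
      exact Algebra.EssFiniteType.comp K Bm L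
    haveI : Algebra.FormallySmooth K L := Algebra.FormallySmooth.of_perfectField
    let e : Localization.AtPrime Q ≃ₐ[G] L :=
      @IsLocalization.algEquiv G _ Q.primeCompl (Localization.AtPrime Q) _ _ _ L _ _ hL
    exact Algebra.FormallySmooth.of_equiv (e.restrictScalars K).symm

end AlgClosed

/-! ## Transport along ring isomorphisms -/

section Transport

/-- **"Regular of dimension one, or an ordinary double point" is a property of the local ring up
to isomorphism**: it transports along ring isomorphisms of local rings (regularity, dimension,
reducedness and the completion all do). [folklore] -/
theorem isRegularLocalRing_or_node_of_ringEquiv {K : Type*} [Field K] {B B' : Type u}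
    [CommRing B] [CommRing B'] [IsLocalRing B] [IsLocalRing B'] (e : B ≃+* B')
    (h : (IsRegularLocalRing B ∧ ringKrullDim B = 1) ∨
      (ringKrullDim B = 1 ∧ IsReduced B ∧ ¬ IsRegularLocalRing B ∧
        Nonempty (AdicCompletion (maximalIdeal B) B ≃+*
          MvPowerSeries (Fin 2) K ⧸
            Ideal.span {(MvPowerSeries.X 0 * MvPowerSeries.X 1 : MvPowerSeries (Fin 2) K)}))) :
    (IsRegularLocalRing B' ∧ ringKrullDim B' = 1) ∨
      (ringKrullDim B' = 1 ∧ IsReduced B' ∧ ¬ IsRegularLocalRing B' ∧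
        Nonempty (AdicCompletion (maximalIdeal B') B' ≃+*
          MvPowerSeries (Fin 2) K ⧸
            Ideal.span {(MvPowerSeries.X 0 * MvPowerSeries.X 1 : MvPowerSeries (Fin 2) K)})) := by
  rcases h with ⟨hreg, hdim⟩ | ⟨hdim, hred, hreg, ⟨f⟩⟩
  · haveI := hreg
    exact Or.inl ⟨IsRegularLocalRing.of_ringEquiv e, by rwa [← ringKrullDim_eq_of_ringEquiv e]⟩
  · refine Or.inr ⟨by rwa [← ringKrullDim_eq_of_ringEquiv e], ?_, fun h' => ?_, ⟨?_⟩⟩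
    · haveI := hred
      exact isReduced_of_injective e.symm.toRingHom e.symm.injective
    · haveI := h'
      exact hreg (IsRegularLocalRing.of_ringEquiv e.symm)
    · refine (adicCompletionCongr (maximalIdeal B) (maximalIdeal B') e ?_).symm.trans f
      rw [RingEquiv.toRingHom_eq_coe, Ideal.map_coe]
      exact map_ringEquiv_maximalIdeal e

/-- Localizations at corresponding primes along a ring isomorphism are isomorphic. [folklore] -/
theorem Localization.nonempty_atPrime_ringEquiv_of_ringEquiv {A G : Type*} [CommRing A]
    [CommRing G] (e : A ≃+* G) (m : Ideal A) [m.IsPrime] :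
    Nonempty (Localization.AtPrime m ≃+* Localization.AtPrime (m.map e)) :=
  ⟨IsLocalization.ringEquivOfRingEquiv (M := m.primeCompl) (Localization.AtPrime m)
    (T := (m.map e).primeCompl) (Localization.AtPrime (m.map e)) e (by
      ext y
      simp only [Submonoid.mem_map]
      constructor
      · rintro ⟨x, hx, rfl⟩ hy
        obtain ⟨x', hx', hxx'⟩ := (Ideal.mem_map_of_equiv e _).mp hy
        have : x' = x := e.injective hxx'
        exact hx (this ▸ hx')
      · intro hy
        refine ⟨e.symm y, fun hx => hy ?_, e.apply_symm_apply y⟩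
        exact (Ideal.mem_map_of_equiv e y).mpr ⟨_, hx, e.apply_symm_apply y⟩)⟩

end Transport

end Literature.AlgebraicGeometry.Resolution

end
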